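import Summits.NavierStokesRegularity.NavierStokesRegularity.Theorems.SqueezeCycleExtremalBiaxialitySubcriticalNoSlackStretching
import Literature.Analysis.FluidPDE.BackwardHeatGradientDoubling
import Literature.Analysis.FluidPDE.VectorCalculus
import Literature.Analysis.FluidPDE.TypeIAncientMild
import HarnessLib

/-!
# Route `SqueezeCycle`, crux `ExtremalBiaxialitySubcritical` — no slack for the Ky Fan compression

Helper file for item `stmt-NavierStokesRegularity-11609`
(`Summit.NavierStokesRegularity.NavierStokesRegularity.Theses.SqueezeCycle.ExtremalBiaxialitySubcritical`),
second line lead (line `oseen-shell-polar-tomography`); it settles the status of the OTHER line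
offered to this lead, `convex-compression-minorant` (crux idea card of ideator 3), whose transfer
target is

  C⁺ = "an attained class-wide maximum `g*` of the gauge Ky Fan compression
        `G = (−t)(λ₁ + λ₂)(sym ∇u)` over `𝒦_C` is `< 1/4`".

By Ky Fan, `λ₁ + λ₂` of the strain is the maximum of `⟪∇u v, v⟫ + ⟪∇u w, w⟫` over orthonormal
pairs `v, w`, so "`G ≤ a` everywhere" is the two-frame statement used below.

* `kyFanCompression_noSlack` — **an element of the Type-I KNSS-mild class whose gauge Ky Fan
  compression is `≤ 1/2 − ε` everywhere vanishes identically.** Proof: for a unit `e` complete it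
  to an orthonormal basis `e, b₁, b₂`; incompressibility gives `⟪∇u e,e⟫ + ⟪∇u b₁,b₁⟫ + ⟪∇u b₂,b₂⟫
  = div u = 0`, so adding the hypothesis for the pairs `(e,b₁)` and `(e,b₂)` yields the gauge
  stretching bound `(−t)⟪∇u e, e⟫ ≤ 1 − 2ε`, and the no-slack Liouville theorem
  `stub_noSlackStretching` (p94840) applies.
* Consequence (recorded here in words; it needs no further Lean): on every NONTRIVIAL class the
  supremum of `G` is `≥ 1/2 > 1/4`, so C⁺ holds iff `𝒦_C = {0}` for every `C`, i.e. iff the route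
  target X (`SqueezeLiouville`) — the convex-compression transfer is X with no slack (the card's own
  "no-slack caveat", now a theorem), exactly as the crux is (`crux_iff_squeezeLiouville`).
-/

noncomputable section

open scoped RealInnerProductSpace InnerProductSpace

set_option linter.dupNamespace false

namespace Summit.NavierStokesRegularity.NavierStokesRegularity.Theorems

open Literature.Analysis.FluidPDE

/-- **No slack for the Ky Fan compression.** An element `u` of the Type-I KNSS-mild class
`IsTypeIAncientMild C u` whose gauge Ky Fan compression is at most `1/2 − ε` everywhere — in
two-frame form: `(−t)(⟪∇u(t,x) v, v⟫ + ⟪∇u(t,x) w, w⟫) ≤ 1/2 − ε` for all `t < 0`, `x` and all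
orthonormal pairs `v, w` — vanishes identically on `t < 0`. (Complete a unit `e` to an orthonormal
basis; `div u = 0` turns the two pair bounds through `e` into `(−t)⟪∇u e, e⟫ ≤ 1 − 2ε`; then
`stub_noSlackStretching`.) Hence every nontrivial Type-I class has `sup G ≥ 1/2`, and the
transfer target "attained class-wide max of `G` is `< 1/4`" of crux idea
`convex-compression-minorant` is equivalent to Liouville on the class. [folklore] -/
theorem kyFanCompression_noSlack :
    ∀ (C : ℝ) (u : ℝ → EuclideanSpace ℝ (Fin 3) → EuclideanSpace ℝ (Fin 3)), IsTypeIAncientMild C u → ∀ ε : ℝ, 0 < ε → (∀ t < 0, ∀ (x v w : EuclideanSpace ℝ (Fin 3)), ‖v‖ = 1 → ‖w‖ = 1 → inner ℝ v w = 0 → (-t) * (inner ℝ (fderiv ℝ (u t) x v) v + inner ℝ (fderiv ℝ (u t) x w) w) ≤ 1 / 2 - ε) → ∀ t < 0, ∀ x : EuclideanSpace ℝ (Fin 3), u t x = 0 := by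
  intro C u hu ε hε hG
  refine stub_noSlackStretching C u hu (2 * ε) (by positivity) ?_
  intro t ht x e he
  -- an orthonormal basis through `e`
  obtain ⟨b, i₀, hbi⟩ := Carleman.exists_orthonormalBasis_apply_eq he
  set A := fderiv ℝ (u t) x with hA
  set f : Fin (Module.finrank ℝ (EuclideanSpace ℝ (Fin 3))) → ℝ := fun i => ⟪A (b i), b i⟫ with hf
  -- incompressibility: the diagonal entries sum to zero
  have hsum : ∑ i, f i = 0 := by
    have h := divergence_eq_sum_inner_fderiv b (u t) x
    rw [hu.isDivFree ht x] at h
    have h' : ∑ i, f i = ∑ i, ⟪b i, fderiv ℝ (u t) x (b i)⟫ :=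
      Finset.sum_congr rfl fun i _ => real_inner_comm _ _
    rw [h']
    exact h.symm
  -- the pair bounds through `e = b i₀`
  have hpair : ∀ i ∈ Finset.univ.erase i₀, (-t) * (f i₀ + f i) ≤ 1 / 2 - ε := by
    intro i hi
    have hne : i ≠ i₀ := Finset.ne_of_mem_erase hi
    have h := hG t ht x (b i₀) (b i) (b.orthonormal.1 i₀) (b.orthonormal.1 i)
      (b.orthonormal.2 (Ne.symm hne))
    simpa only [hf, hA] using h
  -- sum them: `(−t)((n−1) f i₀ + ∑_{i ≠ i₀} f i) ≤ (n−1)(1/2 − ε)` with `n = 3`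
  have hcard : (Finset.univ.erase i₀).card = 2 := by
    rw [Finset.card_erase_of_mem (Finset.mem_univ _), Finset.card_univ, Fintype.card_fin,
      finrank_euclideanSpace_fin]
  have hle := Finset.sum_le_card_nsmul _ _ _ hpair
  rw [hcard, nsmul_eq_mul] at hle
  have hsplit : ∑ i ∈ Finset.univ.erase i₀, (-t) * (f i₀ + f i) =
      (-t) * (2 * f i₀ + ∑ i ∈ Finset.univ.erase i₀, f i) := by
    rw [← Finset.mul_sum, Finset.sum_add_distrib, Finset.sum_const, hcard, nsmul_eq_mul]
    push_cast
    ring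
  have herase : f i₀ + ∑ i ∈ Finset.univ.erase i₀, f i = ∑ i, f i :=
    Finset.add_sum_erase _ _ (Finset.mem_univ _)
  rw [hsplit] at hle
  have ht' : 0 < -t := neg_pos.2 ht
  have key : (-t) * f i₀ ≤ 1 - 2 * ε := by nlinarith [hle, herase, hsum, ht']
  -- `f i₀ = ⟪∇u e, e⟫`
  have hfi : f i₀ = ⟪fderiv ℝ (u t) x e, e⟫ := by simp only [hf, hA, hbi]
  rw [hfi] at key
  linarith

end Summit.NavierStokesRegularity.NavierStokesRegularity.Theorems

end
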